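import Mathlib.Analysis.Normed.Module.Convex
import Literature.Analysis.Complex.VitaliConvergence
import Summits.CriticalPhenomena.CardyFormulaZ2.Theses.CardyUSTContinuation

/-!
# Route CardyUSTContinuation — support item `VitaliContinuation`

The complex-analysis glue of the route (Vitali–Porter + identity theorem), item
stmt-CriticalPhenomena-6053: a family `g δ` of functions analytic on the open `ρ`-neighbourhood
`S` of the real segment `[t₁, 1] ⊆ ℂ` and bounded there by one constant `M`, for all small
`δ > 0`, which converges pointwise on the real interval `(t₁, t₀)` to a function `G` analytic on
`S`, converges to `G 1` at `t = 1` as `δ → 0⁺`.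

Proof. `S` is open and convex (a thickening of a segment), hence connected. Convergence along
the filter `𝓝[>] 0` is convergence along every sequence `δₙ → 0⁺`
(`Filter.tendsto_iff_seq_tendsto`). Along such a sequence the functions `g (δ n)` are, for all
large `n`, holomorphic on `S` and bounded by `M`; replacing the finitely many bad indices by the
zero function gives a uniformly bounded sequence of holomorphic functions on `S` converging
pointwise on the real interval `(t₁, min t₀ 1)`, which accumulates at its midpoint `a`, a point
of `S`. By Vitali's convergence theorem
(`Literature.Analysis.Complex.exists_tendstoLocallyUniformlyOn_of_frequently_tendsto`, from
Montel's theorem) the sequence converges locally uniformly on `S` to a holomorphic `f`; `f = G`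
on that real interval (uniqueness of limits), hence on all of `S` by the identity theorem, and in
particular the values at `1 ∈ S` converge to `f 1 = G 1`.
-/

namespace Summit.CriticalPhenomena.CardyFormulaZ2.Theorems

open Filter Set Metric Topology Complex
open Summit.CriticalPhenomena.CardyFormulaZ2.Theses.CardyUSTContinuation

/-- The real segment `[a, b]`, viewed inside `ℂ`, is convex. -/
theorem convex_ofReal_image_Icc (a b : ℝ) : Convex ℝ (((↑) : ℝ → ℂ) '' Set.Icc a b) := by
  rintro _ ⟨x, hx, rfl⟩ _ ⟨y, hy, rfl⟩ u v hu hv huv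
  refine ⟨u * x + v * y, ?_, ?_⟩
  · have h := convex_Icc a b hx hy hu hv huv
    simpa [smul_eq_mul] using h
  · push_cast
    simp [Complex.real_smul]

/-- **Vitali continuation along the segment** (closes item stmt-CriticalPhenomena-6053 of route
CardyUSTContinuation): if `g δ` is, for all small `δ > 0`, holomorphic on the `ρ`-neighbourhood
`S` of `[t₁, 1] ⊆ ℂ` and bounded there by `M`, `G` is holomorphic on `S`, and `g δ t → G t` as
`δ → 0⁺` for every real `t ∈ (t₁, t₀)`, then `g δ 1 → G 1` as `δ → 0⁺` (Vitali–Porter via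
Montel, plus the identity theorem on the connected open set `S`). -/
theorem vitaliContinuation_proof :
    Summit.CriticalPhenomena.CardyFormulaZ2.Theses.CardyUSTContinuation.VitaliContinuation := by
  unfold VitaliContinuation
  intro t₁ t₀ ρ M ht₁ ht₁₀ ht₁1 hρ g G hg hG hconv
  set K : Set ℂ := ((↑) : ℝ → ℂ) '' Set.Icc t₁ 1 with hK
  set S : Set ℂ := Metric.thickening ρ K with hS
  have hSo : IsOpen S := isOpen_thickening
  have hSc : IsPreconnected S := ((convex_ofReal_image_Icc t₁ 1).thickening ρ).isPreconnected
  have hKS : K ⊆ S := self_subset_thickening hρ K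
  have hmemS : ∀ t ∈ Icc t₁ 1, (t : ℂ) ∈ S := fun t ht => hKS ⟨t, ht, rfl⟩
  -- reduce to sequences `δ n → 0⁺`
  rw [tendsto_iff_seq_tendsto]
  intro δ hδ
  classical
  -- the good indices: `g (δ n)` holomorphic on `S` and bounded by `M`
  set P : ℝ → Prop := fun d => DifferentiableOn ℂ (g d) S ∧ ∀ z ∈ S, ‖g d z‖ ≤ M with hP
  have hPev : ∀ᶠ n in atTop, P (δ n) := hδ.eventually hg
  -- the repaired sequence
  set F : ℕ → ℂ → ℂ := fun n => if P (δ n) then g (δ n) else fun _ => 0 with hF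
  have hFeq : ∀ᶠ n in atTop, F n = g (δ n) := by
    filter_upwards [hPev] with n hn
    simp only [hF, if_pos hn]
  have hFd : ∀ n, DifferentiableOn ℂ (F n) S := by
    intro n
    by_cases hn : P (δ n)
    · simp only [hF, if_pos hn]; exact hn.1
    · simp only [hF, if_neg hn]; exact differentiableOn_const 0
  have hFb : ∀ n, ∀ z ∈ S, ‖F n z‖ ≤ max M 0 := by
    intro n z hz
    by_cases hn : P (δ n)
    · simp only [hF, if_pos hn]; exact (hn.2 z hz).trans (le_max_left _ _)
    · simp only [hF, if_neg hn, norm_zero]; exact le_max_right _ _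
  have hb : ∀ a ∈ S, ∃ M' : ℝ, ∃ r > 0, ∀ n, ∀ z ∈ ball a r ∩ S, ‖F n z‖ ≤ M' :=
    fun a _ => ⟨max M 0, 1, one_pos, fun n z hz => hFb n z hz.2⟩
  -- pointwise convergence on the real interval `(t₁, t₀)`
  have hpt : ∀ t ∈ Ioo t₁ t₀, Tendsto (fun n => F n t) atTop (𝓝 (G t)) := by
    intro t ht
    have h1 : Tendsto (fun n => g (δ n) t) atTop (𝓝 (G t)) := (hconv t ht).comp hδ
    refine h1.congr' ?_
    filter_upwards [hFeq] with n hn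
    rw [hn]
  -- the accumulation point `a`, midpoint of `(t₁, min t₀ 1)`
  set a : ℝ := (t₁ + min t₀ 1) / 2 with ha
  have hmin₁ : t₁ < min t₀ 1 := lt_min ht₁₀ ht₁1
  have ha1 : t₁ < a := by rw [ha]; linarith
  have hamin : a < min t₀ 1 := by rw [ha]; linarith
  have ha3 : a ≤ 1 := (hamin.trans_le (min_le_right t₀ 1)).le
  have haS : (a : ℂ) ∈ S := hmemS a ⟨ha1.le, ha3⟩
  have hnear : ∀ᶠ s : ℝ in 𝓝[>] a, s ∈ Ioo t₁ (min t₀ 1) :=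
    mem_nhdsWithin_of_mem_nhds (isOpen_Ioo.mem_nhds ⟨ha1, hamin⟩)
  have hnear' : ∀ᶠ s : ℝ in 𝓝[>] a, s ∈ Ioo t₁ t₀ ∧ (s : ℂ) ∈ S := by
    filter_upwards [hnear] with s hs
    exact ⟨⟨hs.1, hs.2.trans_le (min_le_left t₀ 1)⟩,
      hmemS s ⟨hs.1.le, (hs.2.trans_le (min_le_right t₀ 1)).le⟩⟩
  -- `ℝ → ℂ` maps the right punctured neighbourhoods of `a` into the punctured ones of `↑a`
  have htend : Tendsto (fun s : ℝ => (s : ℂ)) (𝓝[>] a) (𝓝[≠] (a : ℂ)) := by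
    have h1 : Tendsto (fun s : ℝ => (s : ℂ)) (𝓝[>] a) (𝓝[{(a : ℂ)}ᶜ] (a : ℂ)) :=
      continuous_ofReal.continuousWithinAt.tendsto_nhdsWithin fun s hs =>
        fun h => (ne_of_gt hs) (ofReal_injective h)
    simpa using h1
  have hfreq : ∃ᶠ z in 𝓝[≠] (a : ℂ), ∃ c : ℂ, Tendsto (fun n => F n z) atTop (𝓝 c) := by
    have hev : ∀ᶠ s : ℝ in 𝓝[>] a, ∃ c : ℂ, Tendsto (fun n => F n s) atTop (𝓝 c) := by
      filter_upwards [hnear'] with s hs using ⟨G s, hpt s hs.1⟩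
    exact htend.frequently hev.frequently
  -- Vitali's convergence theorem
  obtain ⟨f, hf, hlim⟩ :=
    Literature.Analysis.Complex.exists_tendstoLocallyUniformlyOn_of_frequently_tendsto hSo hSc
      hFd hb haS hfreq
  -- the limit is `G` (identity theorem)
  have hfG : EqOn f G S := by
    have hev : ∀ᶠ s : ℝ in 𝓝[>] a, f s = G s := by
      filter_upwards [hnear'] with s hs
      exact tendsto_nhds_unique (hlim.tendsto_at hs.2) (hpt s hs.1)
    exact (hf.analyticOnNhd hSo).eqOn_of_preconnected_of_frequently_eq (hG.analyticOnNhd hSo) hSc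
      haS (htend.frequently hev.frequently)
  -- conclude at `1 ∈ S`
  have h1S : (1 : ℂ) ∈ S := by exact_mod_cast hmemS 1 ⟨ht₁1.le, le_rfl⟩
  have hF1 : Tendsto (fun n => F n 1) atTop (𝓝 (G 1)) := by
    rw [← hfG h1S]
    exact hlim.tendsto_at h1S
  refine hF1.congr' ?_
  filter_upwards [hFeq] with n hn
  simp [hn]

end Summit.CriticalPhenomena.CardyFormulaZ2.Theorems
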